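import Summits.Ventures.HodgeRepro2.T5SU11JacobiMeanPhaseRate
import Summits.Ventures.HodgeRepro2.T5SU11JacobiStochasticOrder

/-!
# The weight-`3` dossier, V: the quantitative tail, the pinned moments and the stochastic order at `k = 3`

The fifth dossier specialises the rate chapter (`T5SU11JacobiPhaseLipschitz` … `T5SU11JacobiMeanPhaseRate`) and the
stochastic order (`T5SU11JacobiPhaseTailMonotone`, `T5SU11JacobiStochasticOrder`) to the owner's weight `k = 3`, for
the probability measure `m_3 φ_λ dν/m̂_3(λ)` of the explicit model `π₃⁺` and `0 ≤ λ ≤ 2`, `c = λ(2 − λ)/2`: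

* **the tail of the phase**: `e^{−τ}(1 − c(τ + 1)) ≤ P_{3,λ}(log|a| > τ) ≤ e^{−τ}/(1 − c)` and
  `|P_{3,λ}(log|a| > τ) − e^{−τ}| ≤ c(τ + 2) e^{−τ}` (`tail_prob_three_ge`, `tail_prob_three_le`,
  `abs_tail_prob_three_sub_exp_le`); at `λ = 1`: `|P_{3,1}(log|a| > τ) − e^{−τ}| ≤ (τ + 2) e^{−τ}/2`
  (`abs_tail_prob_three_one_sub_exp_le`) — the phase of `π₃⁺` is `Exp(1)` up to the relative error `c(τ + 2)`;
* **the moments pinned**: `1 − 2c ≤ ⟨log|a|⟩_{3,λ} ≤ 1/(1 − c)` and `2 − 6c ≤ ⟨(log|a|)²⟩_{3,λ} ≤ 2/(1 − c)`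
  (`mean_phase_three_bounds`, `second_moment_phase_three_bounds`);
* **the stochastic order**: for every `k ≥ 3` and every `λ` on the strip `−1 < λ < 3`,
  `P_{k,λ}(log|a| > x) ≤ P_{3,λ}(log|a| > x)`, `P_{k,λ}(|g·0|² > y) ≤ P_{3,λ}(|g·0|² > y)`,
  `P_{k,λ}(t > τ) ≤ P_{3,λ}(t > τ)` (`phase_tail_prob_three_ge`, `orbit_sq_tail_prob_three_ge`,
  `cartan_tail_prob_three_ge`) — the owner's weight is the most spread of all weights `k ≥ 3`.

Nothing is claimed about (N).

Blind lane: Mathlib + the HodgeRepro2 prefix only; no sorry; axioms ⊆ {propext, Classical.choice,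
Quot.sound}.
-/

namespace Summit.Ventures.HodgeRepro2.T5SU11WeightThreeDossierV

open MeasureTheory MeasureTheory.Measure Metric Set Filter Topology
open T5SU11Unimodular T5SU11Fibration T5SU11Cartan T5SU11CartanProjection T5HaarCircle T5BergmanCoefficient
  T5SU11FibrationHaar T5SU11SphericalFunction T5SU11SphericalSymmetry T5SU11SphericalBounds
  T5SU11SphericalContinuous T5SU11JacobiIwasawa T5SU11JacobiTransform T5SU11JacobiWeight
  T5SU11KFiniteMajorantPow T5SU11JacobiLaplacePhase T5SU11JacobiPhaseTailGroup T5SU11JacobiPhaseLawRate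
  T5SU11JacobiMeanPhaseRate T5SU11JacobiPhaseTailMonotone T5SU11JacobiStochasticOrder
open scoped Real

section measure

variable [MeasurableSpace Circle] [BorelSpace Circle]

/-! ### The tail of the phase at `k = 3` -/

/-- **`P_{3,λ}(log|a| > τ) ≤ e^{−τ}/(1 − c)`** for `0 ≤ λ ≤ 2`, `τ ≥ 0`, `c = λ(2 − λ)/2`. -/
theorem tail_prob_three_le {lam τ : ℝ} (h0 : 0 ≤ lam) (h2 : lam ≤ 2) (hτ : 0 ≤ τ) :
    (∫ g in {g : SU11 | τ < Real.log ‖mat g 0 0‖}, (1 - ‖orbit g‖ ^ 2) ^ ((3 : ℝ) / 2) * sph lam g ∂(nu haarCircle))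
        / (∫ g, (1 - ‖orbit g‖ ^ 2) ^ ((3 : ℝ) / 2) * sph lam g ∂(nu haarCircle))
      ≤ Real.exp (-τ) / (1 - lam * (2 - lam) / 2) := by
  have h := tail_prob_le' (k := 3) (lam := lam) (a := τ) le_rfl h0 h2 hτ
  rw [integral_phase_tail_eq (by norm_num) (by linarith) (by linarith) hτ,
    jacobi_eq_laplace_phase (by norm_num) (by linarith) (by linarith),
    mul_div_mul_left _ _ (by positivity : (2 * π : ℝ) ≠ 0)]
  norm_num at h ⊢
  exact h

/-- **`e^{−τ}(1 − c(τ + 1)) ≤ P_{3,λ}(log|a| > τ)`** for `0 ≤ λ ≤ 2`, `τ ≥ 0`. -/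
theorem tail_prob_three_ge {lam τ : ℝ} (h0 : 0 ≤ lam) (h2 : lam ≤ 2) (hτ : 0 ≤ τ) :
    Real.exp (-τ) * (1 - lam * (2 - lam) / 2 * (τ + 1))
      ≤ (∫ g in {g : SU11 | τ < Real.log ‖mat g 0 0‖},
          (1 - ‖orbit g‖ ^ 2) ^ ((3 : ℝ) / 2) * sph lam g ∂(nu haarCircle))
        / (∫ g, (1 - ‖orbit g‖ ^ 2) ^ ((3 : ℝ) / 2) * sph lam g ∂(nu haarCircle)) := by
  have h := tail_prob_ge' (k := 3) (lam := lam) (a := τ) le_rfl h0 h2 hτ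
  rw [integral_phase_tail_eq (by norm_num) (by linarith) (by linarith) hτ,
    jacobi_eq_laplace_phase (by norm_num) (by linarith) (by linarith),
    mul_div_mul_left _ _ (by positivity : (2 * π : ℝ) ≠ 0)]
  norm_num at h ⊢
  exact h

/-- **`|P_{3,λ}(log|a| > τ) − e^{−τ}| ≤ c(τ + 2) e^{−τ}`** for `0 ≤ λ ≤ 2`, `τ ≥ 0`. -/
theorem abs_tail_prob_three_sub_exp_le {lam τ : ℝ} (h0 : 0 ≤ lam) (h2 : lam ≤ 2) (hτ : 0 ≤ τ) :
    |(∫ g in {g : SU11 | τ < Real.log ‖mat g 0 0‖},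
          (1 - ‖orbit g‖ ^ 2) ^ ((3 : ℝ) / 2) * sph lam g ∂(nu haarCircle))
        / (∫ g, (1 - ‖orbit g‖ ^ 2) ^ ((3 : ℝ) / 2) * sph lam g ∂(nu haarCircle)) - Real.exp (-τ)|
      ≤ lam * (2 - lam) / 2 * (τ + 2) * Real.exp (-τ) := by
  have h := abs_phase_tail_prob_sub_exp_le' (k := 3) (lam := lam) (t := τ) le_rfl h0 h2 hτ
  norm_num at h ⊢
  exact h

/-- **At the owner's parameter `λ = 1`**: `|P_{3,1}(log|a| > τ) − e^{−τ}| ≤ (τ + 2) e^{−τ}/2`. -/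
theorem abs_tail_prob_three_one_sub_exp_le {τ : ℝ} (hτ : 0 ≤ τ) :
    |(∫ g in {g : SU11 | τ < Real.log ‖mat g 0 0‖},
          (1 - ‖orbit g‖ ^ 2) ^ ((3 : ℝ) / 2) * sph 1 g ∂(nu haarCircle))
        / (∫ g, (1 - ‖orbit g‖ ^ 2) ^ ((3 : ℝ) / 2) * sph 1 g ∂(nu haarCircle)) - Real.exp (-τ)|
      ≤ (τ + 2) * Real.exp (-τ) / 2 := by
  have h := abs_tail_prob_three_sub_exp_le (lam := 1) (by norm_num) (by norm_num) hτ
  norm_num at h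
  linarith

/-! ### The moments pinned at `k = 3` -/

/-- **`1 − 2c ≤ ⟨log|a|⟩_{3,λ} ≤ 1/(1 − c)`** for `0 ≤ λ ≤ 2`, `c = λ(2 − λ)/2`. -/
theorem mean_phase_three_bounds {lam : ℝ} (h0 : 0 ≤ lam) (h2 : lam ≤ 2) :
    1 - 2 * (lam * (2 - lam) / 2)
      ≤ (∫ g, Real.log ‖mat g 0 0‖ * ((1 - ‖orbit g‖ ^ 2) ^ ((3 : ℝ) / 2) * sph lam g) ∂(nu haarCircle))
          / (∫ g, (1 - ‖orbit g‖ ^ 2) ^ ((3 : ℝ) / 2) * sph lam g ∂(nu haarCircle))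
    ∧ (∫ g, Real.log ‖mat g 0 0‖ * ((1 - ‖orbit g‖ ^ 2) ^ ((3 : ℝ) / 2) * sph lam g) ∂(nu haarCircle))
          / (∫ g, (1 - ‖orbit g‖ ^ 2) ^ ((3 : ℝ) / 2) * sph lam g ∂(nu haarCircle))
        ≤ 1 / (1 - lam * (2 - lam) / 2) := by
  have hlo := le_normalized_moment 1 (k := 3) (lam := lam) (by norm_num) h0 h2
  have hup := normalized_moment_le 1 (k := 3) (lam := lam) le_rfl h0 h2
  simp only [pow_one, Nat.factorial_one, Nat.cast_one, Nat.reduceAdd, Nat.factorial_two, Nat.cast_ofNat]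
    at hlo hup
  norm_num at hlo hup
  exact ⟨by linarith, by rw [one_div]; exact hup⟩

/-- **`2 − 6c ≤ ⟨(log|a|)²⟩_{3,λ} ≤ 2/(1 − c)`** for `0 ≤ λ ≤ 2`, `c = λ(2 − λ)/2`. -/
theorem second_moment_phase_three_bounds {lam : ℝ} (h0 : 0 ≤ lam) (h2 : lam ≤ 2) :
    2 - 6 * (lam * (2 - lam) / 2)
      ≤ (∫ g, Real.log ‖mat g 0 0‖ ^ 2 * ((1 - ‖orbit g‖ ^ 2) ^ ((3 : ℝ) / 2) * sph lam g) ∂(nu haarCircle))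
          / (∫ g, (1 - ‖orbit g‖ ^ 2) ^ ((3 : ℝ) / 2) * sph lam g ∂(nu haarCircle))
    ∧ (∫ g, Real.log ‖mat g 0 0‖ ^ 2 * ((1 - ‖orbit g‖ ^ 2) ^ ((3 : ℝ) / 2) * sph lam g) ∂(nu haarCircle))
          / (∫ g, (1 - ‖orbit g‖ ^ 2) ^ ((3 : ℝ) / 2) * sph lam g ∂(nu haarCircle))
        ≤ 2 / (1 - lam * (2 - lam) / 2) := by
  have hlo := le_normalized_moment 2 (k := 3) (lam := lam) (by norm_num) h0 h2
  have hup := normalized_moment_le 2 (k := 3) (lam := lam) le_rfl h0 h2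
  have hf3 : ((2 + 1).factorial : ℝ) = 6 := by norm_num [Nat.factorial]
  simp only [Nat.factorial_two, Nat.cast_ofNat, hf3, Nat.reduceAdd] at hlo hup
  norm_num at hlo hup
  exact ⟨by linarith, hup⟩

/-! ### The stochastic order: `k = 3` is the most spread weight -/

/-- **`P_{k,λ}(log|a| > x) ≤ P_{3,λ}(log|a| > x)`** for `k ≥ 3`, `−1 < λ < 3`, `x ≥ 0`. -/
theorem phase_tail_prob_three_ge {k lam : ℝ} (hk : 3 ≤ k) (h1 : -1 < lam) (h2 : lam < 3) {x : ℝ}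
    (hx : 0 ≤ x) :
    (∫ g in {g : SU11 | x < Real.log ‖mat g 0 0‖}, (1 - ‖orbit g‖ ^ 2) ^ (k / 2) * sph lam g ∂(nu haarCircle))
        / (∫ g, (1 - ‖orbit g‖ ^ 2) ^ (k / 2) * sph lam g ∂(nu haarCircle))
      ≤ (∫ g in {g : SU11 | x < Real.log ‖mat g 0 0‖},
          (1 - ‖orbit g‖ ^ 2) ^ ((3 : ℝ) / 2) * sph lam g ∂(nu haarCircle))
        / (∫ g, (1 - ‖orbit g‖ ^ 2) ^ ((3 : ℝ) / 2) * sph lam g ∂(nu haarCircle)) :=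
  phase_tail_prob_antitone (k₁ := 3) (by norm_num) h2 (by linarith) hk hx

/-- **`P_{k,λ}(|g·0|² > y) ≤ P_{3,λ}(|g·0|² > y)`** for `k ≥ 3`, `−1 < λ < 3`, `0 ≤ y < 1`. -/
theorem orbit_sq_tail_prob_three_ge {k lam : ℝ} (hk : 3 ≤ k) (h1 : -1 < lam) (h2 : lam < 3) {y : ℝ}
    (hy0 : 0 ≤ y) (hy1 : y < 1) :
    (∫ g in {g : SU11 | y < ‖orbit g‖ ^ 2}, (1 - ‖orbit g‖ ^ 2) ^ (k / 2) * sph lam g ∂(nu haarCircle))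
        / (∫ g, (1 - ‖orbit g‖ ^ 2) ^ (k / 2) * sph lam g ∂(nu haarCircle))
      ≤ (∫ g in {g : SU11 | y < ‖orbit g‖ ^ 2}, (1 - ‖orbit g‖ ^ 2) ^ ((3 : ℝ) / 2) * sph lam g ∂(nu haarCircle))
        / (∫ g, (1 - ‖orbit g‖ ^ 2) ^ ((3 : ℝ) / 2) * sph lam g ∂(nu haarCircle)) :=
  orbit_sq_tail_prob_antitone (k₁ := 3) (by norm_num) h2 (by linarith) hk hy0 hy1

/-- **`P_{k,λ}(t(g) > τ) ≤ P_{3,λ}(t(g) > τ)`** for `k ≥ 3`, `−1 < λ < 3`, `τ ≥ 0`. -/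
theorem cartan_tail_prob_three_ge {k lam : ℝ} (hk : 3 ≤ k) (h1 : -1 < lam) (h2 : lam < 3) {τ : ℝ}
    (hτ : 0 ≤ τ) :
    (∫ g in {g : SU11 | τ < cartanT g}, (1 - ‖orbit g‖ ^ 2) ^ (k / 2) * sph lam g ∂(nu haarCircle))
        / (∫ g, (1 - ‖orbit g‖ ^ 2) ^ (k / 2) * sph lam g ∂(nu haarCircle))
      ≤ (∫ g in {g : SU11 | τ < cartanT g}, (1 - ‖orbit g‖ ^ 2) ^ ((3 : ℝ) / 2) * sph lam g ∂(nu haarCircle))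
        / (∫ g, (1 - ‖orbit g‖ ^ 2) ^ ((3 : ℝ) / 2) * sph lam g ∂(nu haarCircle)) :=
  cartan_tail_prob_antitone (k₁ := 3) (by norm_num) h2 (by linarith) hk hτ

end measure

end Summit.Ventures.HodgeRepro2.T5SU11WeightThreeDossierV
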